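import Literature.NumberTheory.Sieve.PolymathLcmSumsZeta
import Literature.NumberTheory.Sieve.PolymathLcmSumsFourier
import HarnessLib

/-!
# Polymath 8b, Lemma 4.1: the sum (multisum) as the integral (fg-int) of the kernel `K` against the Fourier weights

Trunk: AntSieve / parity.S13.  Part of the proof (fifth layer of the decomposition of the named fact
`Literature.NumberTheory.Sieve.frequently_nth_prime_succ_le_add_polymath`, `H₁ ≤ 246`) of the key
asymptotic Lemma 4.1 of D. H. J. Polymath, *Variants of the Selberg sieve, and bounded intervals
containing many primes*, Res. Math. Sci. 1:12 (2014) = arXiv:1407.4897, p. 12 (the named fact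
`Literature.NumberTheory.Sieve.moebiusLcmSums_asymptotic` of `PolymathLcmSums.lean`).  This file
carries out the first step of the printed proof — "if we substitute the Fourier expansions into the
left-hand side of (multisum), the resulting expression is absolutely convergent.  Thus we can apply
Fubini's theorem, and the left-hand side of (multisum) can thus be rewritten as
`∫_ℝ … ∫_ℝ K(ξ_1,…,ξ_k,ξ'_1,…,ξ'_k) ∏_j f_j(ξ_j) g_j(ξ'_j) dξ_j dξ'_j`" ((fg-int), p. 12) — for a
general denominator weight `w` (`IsLcmWeight`: `1/[d_j,d'_j]` and the variant `1/φ([d_j,d'_j])`),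
everything PROVED:

* `lcmTermW`, `lcmSumW`: the sum (multisum) with the weight `w([d_j,d'_j])` (complex-valued);
  `ofReal_lcmSum`: `lcmSum` (`PolymathLcmSums.lean`) is the case `w(n) = 1/n`.
* `LcmEuler.sOf ξ = 1 - 2πiξ` (the paper's `1 + iξ` in Mathlib's normalisation of `𝓕`), the
  exponents `expA x p j = s(ξ_j)/log x`, `expB x p j = s(ξ'_j)/log x` (common real part `1/log x`),
  and `IsSieveCutoff.apply_log_div_eq_integral`: "`F_j(log_x d_j) = ∫ f_j(ξ_j) d_j^{-(1+iξ_j)/log x} dξ_j`".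
* `LcmEuler.fourierPhi hF hG p = Φ(ξ,ξ') = ∏_j f_j(ξ_j) g_j(ξ'_j)` on the frequency space
  `ι → ℝ × ℝ` (continuous, integrable), and the term-wise identity
  `integral_fourierPhi_mul_eulerTerm`: `∫ Φ · eulerTerm_{(d,d')}(a(ξ), b(ξ')) = ` the `(d,d')`-term of
  (multisum) (Fubini over the `2k` one-dimensional Fourier integrals, `integral_fintype_prod_volume_eq_prod`).
* `LcmEuler.boxKernel` (the kernel summed over `[1,D]^{2k}`, continuous, bounded by `kernelBound`),
  `lcmSumW_eq_integral_boxKernel` (the sum over a box is `∫ Φ K_D`), `lcmSumW_eq_of_le` (the sum is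
  constant in `D ≥ ⌊x^T⌋` once `T` bounds the supports of the cutoffs), and
* `LcmEuler.freqKernel w W x p = K_x(ξ,ξ')` (the kernel `eulerKernel` of `PolymathLcmSumsEuler.lean` at
  the exponents above; a.e.-measurable as the pointwise limit of the `K_D`, bounded by `kernelBound`)
  with the representation **`lcmSumW_eq_integral_freqKernel`**:
  `lcmSumW w W F G x ⌊x^T⌋ = ∫ Φ(p) K_x(p) dp` for `x > 1` (dominated convergence in `D`, using the
  uniform bound `norm_sum_eulerTerm_le` and `tendsto_sum_lcmBox_eulerTerm`).

The asymptotic evaluation of `∫ Φ K_x` (the pole of `ζ`, the cube `|ξ| ≤ √log x`, the tails) is in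
`PolymathLcmSumsMainTerm.lean` / `PolymathLcmSumsProofs.lean`.

## References

* D. H. J. Polymath, *Variants of the Selberg sieve, and bounded intervals containing many primes*,
  Res. Math. Sci. 1 (2014), Art. 12; arXiv:1407.4897, proof of Lemma 4.1, p. 12, (etf)–(fg-int).
  [Polymath8b2014]
-/

noncomputable section

open MeasureTheory Filter Finset Asymptotics Real
open scoped BigOperators Topology ArithmeticFunction.Moebius

namespace Literature.NumberTheory.Sieve

variable {ι : Type*} [Fintype ι] [DecidableEq ι]

/-! ### The sum (multisum) with a general denominator weight -/

/-- The summand of (multisum) with a general denominator weight `w`: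
`∏_j μ(d_j) μ(d'_j) F_j(log_x d_j) G_j(log_x d'_j) w([d_j,d'_j])` (`w(n) = 1/n` is the printed
(multisum), `w(n) = 1/φ(n)` its variant "with `φ([d_j,d'_j])` in place of `[d_j,d'_j]`").
[cite: Polymath8b2014, Lemma 4.1] -/
def lcmTermW (w : ℕ → ℂ) (F G : ι → ℝ → ℝ) (x : ℝ) (d d' : ι → ℕ) : ℂ :=
  ∏ j, (μ (d j) : ℂ) * μ (d' j) * F j (Real.log (d j) / Real.log x) *
    G j (Real.log (d' j) / Real.log x) * w (Nat.lcm (d j) (d' j))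

/-- The left-hand side of (multisum) with a general denominator weight `w : ℕ → ℂ`, over the box
`[1, D]^{2k}` and with the coprimality condition "`[d_1,d'_1], …, [d_k,d'_k], W` coprime"
(`lcmSum` is the case `w(n) = 1/n`, see `ofReal_lcmSum`). [cite: Polymath8b2014, Lemma 4.1] -/
def lcmSumW (w : ℕ → ℂ) (W : ℕ) (F G : ι → ℝ → ℝ) (x : ℝ) (D : ℕ) : ℂ :=
  ∑ d ∈ lcmBox ι D, ∑ d' ∈ lcmBox ι D, if LcmCoprime W d d' then lcmTermW w F G x d d' else 0

/-- `lcmSum` is the real sum `lcmSumW` with the weight `w(n) = 1/n`. [folklore] -/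
theorem ofReal_lcmSum (W : ℕ) (F G : ι → ℝ → ℝ) (x : ℝ) (D : ℕ) :
    ((lcmSum W F G x D : ℝ) : ℂ) = lcmSumW (fun n => (n : ℂ)⁻¹) W F G x D := by
  unfold lcmSum lcmSumW
  push_cast
  refine Finset.sum_congr rfl fun d _ => Finset.sum_congr rfl fun d' _ => ?_
  split_ifs
  · unfold lcmTerm lcmTermW
    push_cast
    refine Finset.prod_congr rfl fun j _ => ?_
    rw [div_eq_mul_inv]
  · rfl

namespace LcmEuler

/-! ### The exponents `(1 - 2πiξ)/log x` -/

/-- `s(ξ) := 1 - 2πiξ` (the paper's `1 + iξ` in Mathlib's normalisation of the Fourier transform).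
[cite: Polymath8b2014, Lemma 4.1 (proof)] -/
def sOf (ξ : ℝ) : ℂ := 1 - 2 * π * Complex.I * ξ

omit [Fintype ι] [DecidableEq ι] in
/-- `Re s(ξ) = 1`. [folklore] -/
@[simp] theorem sOf_re (ξ : ℝ) : (sOf ξ).re = 1 := by
  simp [sOf, Complex.mul_re]

omit [Fintype ι] [DecidableEq ι] in
/-- `s(ξ) ≠ 0`. [folklore] -/
theorem sOf_ne_zero (ξ : ℝ) : sOf ξ ≠ 0 := fun h => by simpa using congrArg Complex.re h

omit [Fintype ι] [DecidableEq ι] in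
/-- `1 ≤ ‖s(ξ)‖`. [folklore] -/
theorem one_le_norm_sOf (ξ : ℝ) : 1 ≤ ‖sOf ξ‖ := by
  have h := Complex.abs_re_le_norm (sOf ξ)
  rwa [sOf_re, abs_one] at h

omit [Fintype ι] [DecidableEq ι] in
/-- `‖s(ξ)‖ ≤ 1 + 2π|ξ|`. [folklore] -/
theorem norm_sOf_le (ξ : ℝ) : ‖sOf ξ‖ ≤ 1 + 2 * π * |ξ| := norm_one_sub_twoPiI_le ξ

omit [Fintype ι] [DecidableEq ι] in
/-- `s(ξ) + s(ξ') = 2 - 2πi(ξ + ξ')`. [folklore] -/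
theorem sOf_add_sOf (ξ ξ' : ℝ) : sOf ξ + sOf ξ' = 2 - 2 * π * Complex.I * (ξ + ξ') := by
  simp only [sOf]; ring

omit [Fintype ι] [DecidableEq ι] in
/-- The pair kernel is `s(ξ)s(ξ')/(s(ξ) + s(ξ'))`. [folklore] -/
theorem lcmPairKernel_eq (q : ℝ × ℝ) : lcmPairKernel q = sOf q.1 * sOf q.2 / (sOf q.1 + sOf q.2) := by
  rw [lcmPairKernel, sOf_add_sOf]; rfl

/-- The exponents `a_j = s(ξ_j)/log x`. [cite: Polymath8b2014, Lemma 4.1 (proof)] -/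
def expA (x : ℝ) (p : ι → ℝ × ℝ) : ι → ℂ := fun j => sOf (p j).1 / (Real.log x : ℂ)

/-- The exponents `b_j = s(ξ'_j)/log x`. [cite: Polymath8b2014, Lemma 4.1 (proof)] -/
def expB (x : ℝ) (p : ι → ℝ × ℝ) : ι → ℂ := fun j => sOf (p j).2 / (Real.log x : ℂ)

omit [Fintype ι] [DecidableEq ι] in
/-- `Re (s(ξ)/L) = 1/L`. [folklore] -/
theorem sOf_div_re (ξ L : ℝ) : (sOf ξ / (L : ℂ)).re = 1 / L := by
  rw [Complex.div_ofReal_re, sOf_re]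

omit [Fintype ι] [DecidableEq ι] in
/-- The exponents have common real part `σ = 1/log x`. [folklore] -/
theorem expA_re_expB_re (x : ℝ) (p : ι → ℝ × ℝ) (j : ι) :
    (expA x p j).re = 1 / Real.log x ∧ (expB x p j).re = 1 / Real.log x :=
  ⟨sOf_div_re _ _, sOf_div_re _ _⟩

omit [Fintype ι] [DecidableEq ι] in
/-- `e^{-t s(ξ)}` at `t = log d / L` is `d^{-s(ξ)/L}`. [folklore] -/
theorem lcmFourierKernel_log_div {d : ℕ} (hd : 0 < d) (L ξ : ℝ) :
    lcmFourierKernel (Real.log d / L) ξ = (d : ℂ) ^ (-(sOf ξ / (L : ℂ))) := by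
  have hdc : (d : ℂ) ≠ 0 := by exact_mod_cast hd.ne'
  rw [Complex.cpow_def_of_ne_zero hdc, ← Complex.natCast_log, lcmFourierKernel, sOf]
  congr 1
  push_cast
  ring

omit [Fintype ι] [DecidableEq ι] in
/-- **"`F_j(log_x d_j) = ∫ f_j(ξ) d_j^{-(1+iξ)/log x} dξ`"** (Polymath 8b p. 12) for `d ≥ 1`.
[cite: Polymath8b2014, Lemma 4.1 (proof, p. 12)] -/
theorem IsSieveCutoff.apply_log_div_eq_integral {F : ℝ → ℝ} {s : ℝ} (hF : IsSieveCutoff F s)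
    {d : ℕ} (hd : 0 < d) {L : ℝ} (hL : 0 < L) :
    (F (Real.log d / L) : ℂ) = ∫ ξ : ℝ, hF.fourierWeight ξ * (d : ℂ) ^ (-(sOf ξ / (L : ℂ))) := by
  have ht : -1 ≤ Real.log d / L :=
    le_trans (by norm_num) (div_nonneg (Real.log_natCast_nonneg d) hL.le)
  rw [hF.eq_integral_fourierWeight ht]
  refine integral_congr_ae (Eventually.of_forall fun ξ => ?_)
  beta_reduce
  rw [lcmFourierKernel_log_div hd]


/-! ### The Fourier weight `Φ(ξ, ξ') = ∏_j f_j(ξ_j) g_j(ξ'_j)` and the term-wise identity -/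

section Phi

variable {F G : ι → ℝ → ℝ} {sF sG : ι → ℝ}

/-- `Φ(ξ, ξ') := ∏_j f_j(ξ_j) g_j(ξ'_j)`, the product of the Fourier weights in (fg-int)
(Polymath 8b p. 12), on the `2k`-dimensional frequency space `ι → ℝ × ℝ`.
[cite: Polymath8b2014, Lemma 4.1 (proof, (fg-int))] -/
def fourierPhi (hF : ∀ j, IsSieveCutoff (F j) (sF j)) (hG : ∀ j, IsSieveCutoff (G j) (sG j))
    (p : ι → ℝ × ℝ) : ℂ :=
  ∏ j, (hF j).fourierWeight (p j).1 * (hG j).fourierWeight (p j).2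

variable (hF : ∀ j, IsSieveCutoff (F j) (sF j)) (hG : ∀ j, IsSieveCutoff (G j) (sG j))

omit [DecidableEq ι] in
/-- `Φ` is continuous. [folklore] -/
theorem continuous_fourierPhi : Continuous (fourierPhi hF hG) := by
  unfold fourierPhi
  refine continuous_finsetProd _ fun j _ => ?_
  exact (((hF j).continuous_fourierWeight).comp (continuous_fst.comp (continuous_apply j))).mul
    (((hG j).continuous_fourierWeight).comp (continuous_snd.comp (continuous_apply j)))

omit [DecidableEq ι] in
/-- `Φ` is integrable on `ℝ^{2k}`. [folklore] -/
theorem integrable_fourierPhi : Integrable (fourierPhi hF hG) := by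
  have h : ∀ j, Integrable (fun q : ℝ × ℝ => (hF j).fourierWeight q.1 * (hG j).fourierWeight q.2) :=
    fun j => ((hF j).integrable_fourierWeight).mul_prod ((hG j).integrable_fourierWeight)
  have h2 := Integrable.fintype_prod h
  exact h2

omit [Fintype ι] [DecidableEq ι] in
/-- The exponent maps `p ↦ d^{-a_j(p)}` are continuous (for `d ≥ 1`). [folklore] -/
theorem continuous_cpow_expA {d : ℕ} (hd : 0 < d) (x : ℝ) (j : ι) :
    Continuous fun p : ι → ℝ × ℝ => (d : ℂ) ^ (-(expA x p j)) := by
  have hc : Continuous fun p : ι → ℝ × ℝ => -(expA x p j) := by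
    unfold expA sOf
    exact ((continuous_const.sub (continuous_const.mul (Complex.continuous_ofReal.comp
      (continuous_fst.comp (continuous_apply j))))).div_const _).neg
  exact hc.const_cpow (Or.inl (by exact_mod_cast hd.ne'))

omit [Fintype ι] [DecidableEq ι] in
/-- The exponent maps `p ↦ d^{-b_j(p)}` are continuous (for `d ≥ 1`). [folklore] -/
theorem continuous_cpow_expB {d : ℕ} (hd : 0 < d) (x : ℝ) (j : ι) :
    Continuous fun p : ι → ℝ × ℝ => (d : ℂ) ^ (-(expB x p j)) := by
  have hc : Continuous fun p : ι → ℝ × ℝ => -(expB x p j) := by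
    unfold expB sOf
    exact ((continuous_const.sub (continuous_const.mul (Complex.continuous_ofReal.comp
      (continuous_snd.comp (continuous_apply j))))).div_const _).neg
  exact hc.const_cpow (Or.inl (by exact_mod_cast hd.ne'))

/-- `p ↦ eulerTerm(a(p), b(p), t)` is continuous when the entries of `t` are positive. [folklore] -/
theorem continuous_eulerTerm (w : ℕ → ℂ) (W : ℕ) (x : ℝ) {t : (ι → ℕ) × (ι → ℕ)}
    (ht : ∀ j, 0 < t.1 j ∧ 0 < t.2 j) :
    Continuous fun p : ι → ℝ × ℝ => eulerTerm w W (expA x p) (expB x p) t := by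
  unfold eulerTerm
  by_cases hc : LcmCoprime W t.1 t.2
  · simp only [if_pos hc, pairSummandW]
    refine continuous_finsetProd _ fun j _ => ?_
    exact (((continuous_const.mul (continuous_cpow_expA (ht j).1 x j)).mul
      (continuous_const.mul (continuous_cpow_expB (ht j).2 x j))).mul continuous_const)
  · simp only [if_neg hc]
    exact continuous_const

/-- Entries of the box `[1, D]^ι` are positive. [folklore] -/
theorem pos_of_mem_lcmBox {D : ℕ} {d : ι → ℕ} (hd : d ∈ lcmBox ι D) (j : ι) : 0 < d j := by
  simp only [lcmBox, Fintype.mem_piFinset, Finset.mem_Icc] at hd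
  exact (hd j).1

/-- **Substituting the Fourier expansions into one term of (multisum)** (Polymath 8b p. 12): for
`d_j, d'_j ≥ 1`,
`∫ Φ(ξ,ξ') · eulerTerm_{(d,d')}(a(ξ), b(ξ')) dξ dξ' = [the (d,d')-term of (multisum)]`, i.e. the
product over `j` of `μ(d_j)μ(d'_j) w([d_j,d'_j]) F_j(log_x d_j) G_j(log_x d'_j)` (and `0` if the
coprimality condition fails). [cite: Polymath8b2014, Lemma 4.1 (proof, p. 12)] -/
theorem integral_fourierPhi_mul_eulerTerm (w : ℕ → ℂ) (W : ℕ) {x : ℝ} (hx : 1 < x)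
    (d d' : ι → ℕ) (hd : ∀ j, 0 < d j) (hd' : ∀ j, 0 < d' j) :
    ∫ p : ι → ℝ × ℝ, fourierPhi hF hG p * eulerTerm w W (expA x p) (expB x p) (d, d') =
      if LcmCoprime W d d' then lcmTermW w F G x d d' else 0 := by
  have hL : 0 < Real.log x := Real.log_pos hx
  by_cases hc : LcmCoprime W d d'
  · rw [if_pos hc]
    -- the integrand as a product over `j` of functions of `(ξ_j, ξ'_j)`
    set φ : ι → ℝ × ℝ → ℂ := fun j q =>
      ((hF j).fourierWeight q.1 * ((μ (d j) : ℂ) * (d j : ℂ) ^ (-(sOf q.1 / (Real.log x : ℂ))))) *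
        ((hG j).fourierWeight q.2 * ((μ (d' j) : ℂ) * (d' j : ℂ) ^ (-(sOf q.2 / (Real.log x : ℂ))))) *
        w (Nat.lcm (d j) (d' j)) with hφ
    have hpt : ∀ p : ι → ℝ × ℝ, fourierPhi hF hG p * eulerTerm w W (expA x p) (expB x p) (d, d') =
        ∏ j, φ j (p j) := by
      intro p
      rw [eulerTerm, if_pos hc, fourierPhi, pairSummandW, ← Finset.prod_mul_distrib]
      refine Finset.prod_congr rfl fun j _ => ?_
      simp only [hφ, expA, expB]
      ring
    simp_rw [hpt]
    rw [integral_fintype_prod_volume_eq_prod, lcmTermW]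
    refine Finset.prod_congr rfl fun j _ => ?_
    have h1 : ∫ q : ℝ × ℝ, φ j q =
        (∫ ξ : ℝ, (hF j).fourierWeight ξ * ((μ (d j) : ℂ) * (d j : ℂ) ^ (-(sOf ξ / (Real.log x : ℂ))))) *
        (∫ ξ : ℝ, (hG j).fourierWeight ξ * ((μ (d' j) : ℂ) * (d' j : ℂ) ^ (-(sOf ξ / (Real.log x : ℂ))))) *
        w (Nat.lcm (d j) (d' j)) := by
      simp only [hφ]
      rw [integral_mul_const, ← integral_prod_mul]
      rfl
    have h2 : ∫ ξ : ℝ, (hF j).fourierWeight ξ * ((μ (d j) : ℂ) * (d j : ℂ) ^ (-(sOf ξ / (Real.log x : ℂ)))) =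
        (μ (d j) : ℂ) * F j (Real.log (d j) / Real.log x) := by
      rw [IsSieveCutoff.apply_log_div_eq_integral (hF j) (hd j) hL, ← integral_const_mul]
      refine integral_congr_ae (Eventually.of_forall fun ξ => ?_)
      beta_reduce; ring
    have h3 : ∫ ξ : ℝ, (hG j).fourierWeight ξ * ((μ (d' j) : ℂ) * (d' j : ℂ) ^ (-(sOf ξ / (Real.log x : ℂ)))) =
        (μ (d' j) : ℂ) * G j (Real.log (d' j) / Real.log x) := by
      rw [IsSieveCutoff.apply_log_div_eq_integral (hG j) (hd' j) hL, ← integral_const_mul]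
      refine integral_congr_ae (Eventually.of_forall fun ξ => ?_)
      beta_reduce; ring
    rw [h1, h2, h3]
    ring
  · rw [if_neg hc]
    have hpt : ∀ p : ι → ℝ × ℝ, fourierPhi hF hG p * eulerTerm w W (expA x p) (expB x p) (d, d') = 0 := by
      intro p
      rw [eulerTerm, if_neg hc, mul_zero]
    simp_rw [hpt]
    exact integral_zero _ _

end Phi

/-! ### The sum over a box as an integral, and the limit `D → ∞` -/

section Box

variable {F G : ι → ℝ → ℝ} {sF sG : ι → ℝ}

/-- The kernel summed over the box `[1,D]^{2k}`:
`K_D(ξ,ξ') := ∑_{d, d' ∈ [1,D]^k} eulerTerm_{(d,d')}(a(ξ), b(ξ'))` (its limit as `D → ∞` is `K`,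
`tendsto_sum_lcmBox_eulerTerm`). [cite: Polymath8b2014, Lemma 4.1 (proof, definition of K)] -/
def boxKernel (w : ℕ → ℂ) (W : ℕ) (x : ℝ) (D : ℕ) (p : ι → ℝ × ℝ) : ℂ :=
  ∑ t ∈ lcmBox ι D ×ˢ lcmBox ι D, eulerTerm w W (expA x p) (expB x p) t

/-- `K_D` is continuous in the frequencies. [folklore] -/
theorem continuous_boxKernel (w : ℕ → ℂ) (W : ℕ) (x : ℝ) (D : ℕ) :
    Continuous (boxKernel (ι := ι) w W x D) := by
  unfold boxKernel
  refine continuous_finsetSum _ fun t ht => ?_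
  rw [Finset.mem_product] at ht
  exact continuous_eulerTerm w W x fun j => ⟨pos_of_mem_lcmBox ht.1 j, pos_of_mem_lcmBox ht.2 j⟩

/-- `‖K_D‖ ≤ kernelBound k (1/log x)` uniformly (`norm_sum_eulerTerm_le`). [folklore] -/
theorem norm_boxKernel_le {w : ℕ → ℂ} (hw : IsLcmWeight w) (W : ℕ) {x : ℝ} (hx : 1 < x) (D : ℕ)
    (p : ι → ℝ × ℝ) :
    ‖boxKernel w W x D p‖ ≤ kernelBound (Fintype.card ι) (1 / Real.log x) :=
  norm_sum_eulerTerm_le hw (one_div_pos.2 (Real.log_pos hx)) (expA_re_expB_re x p) _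

/-- **(multisum) over the box `[1,D]^{2k}` equals `∫ Φ · K_D`** (finite sum of the term-wise
identities `integral_fourierPhi_mul_eulerTerm`). [cite: Polymath8b2014, Lemma 4.1 (proof, (fg-int))] -/
theorem lcmSumW_eq_integral_boxKernel (hF : ∀ j, IsSieveCutoff (F j) (sF j))
    (hG : ∀ j, IsSieveCutoff (G j) (sG j)) (w : ℕ → ℂ) (W : ℕ) {x : ℝ} (hx : 1 < x) (D : ℕ) :
    lcmSumW w W F G x D = ∫ p : ι → ℝ × ℝ, fourierPhi hF hG p * boxKernel w W x D p := by
  have hint : ∀ t ∈ lcmBox ι D ×ˢ lcmBox ι D, Integrable fun p : ι → ℝ × ℝ =>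
      fourierPhi hF hG p * eulerTerm w W (expA x p) (expB x p) t := by
    intro t ht
    rw [Finset.mem_product] at ht
    have hpos : ∀ j, 0 < t.1 j ∧ 0 < t.2 j :=
      fun j => ⟨pos_of_mem_lcmBox ht.1 j, pos_of_mem_lcmBox ht.2 j⟩
    have h := (integrable_fourierPhi hF hG).bdd_mul (c := absSummand (1 / Real.log x) w t)
      (continuous_eulerTerm w W x hpos).aestronglyMeasurable
      (ae_of_all _ fun p => (norm_eulerTerm_le w (W := W) (expA_re_expB_re x p) t).trans (by
        split_ifs
        · exact le_rfl
        · exact Finset.prod_nonneg fun j _ => by positivity))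
    exact h.congr (ae_of_all _ fun p => mul_comm _ _)
  unfold lcmSumW boxKernel
  simp_rw [Finset.mul_sum]
  rw [integral_finsetSum _ hint, Finset.sum_product]
  refine Finset.sum_congr rfl fun d hd => Finset.sum_congr rfl fun d' hd' => ?_
  rw [integral_fourierPhi_mul_eulerTerm hF hG w W hx d d' (pos_of_mem_lcmBox hd) (pos_of_mem_lcmBox hd')]

omit [DecidableEq ι] in
/-- A term of (multisum) vanishes as soon as some `d_j > x^T` (then `log_x d_j > T ≥ S(F_j)`).
[folklore] -/
theorem lcmTermW_eq_zero_of_lt (hF : ∀ j, IsSieveCutoff (F j) (sF j)) (w : ℕ → ℂ) {x T : ℝ}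
    (hx : 1 < x) (hT : ∀ j, sF j ≤ T)
    {d d' : ι → ℕ} {j : ι} (hj : x ^ T < d j) : lcmTermW w F G x d d' = 0 := by
  have hL : 0 < Real.log x := Real.log_pos hx
  have hx0 : 0 < x := by linarith
  have hlog : T < Real.log (d j) / Real.log x := by
    rw [lt_div_iff₀ hL, ← Real.log_rpow hx0]
    exact Real.log_lt_log (Real.rpow_pos_of_pos hx0 T) hj
  unfold lcmTermW
  refine Finset.prod_eq_zero (Finset.mem_univ j) ?_
  rw [(hF j).eq_zero _ (lt_of_le_of_lt (hT j) hlog)]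
  simp

omit [DecidableEq ι] in
/-- Symmetrically in the `d'`-variables. [folklore] -/
theorem lcmTermW_eq_zero_of_lt' (hG : ∀ j, IsSieveCutoff (G j) (sG j)) (w : ℕ → ℂ) {x T : ℝ}
    (hx : 1 < x) (hT : ∀ j, sG j ≤ T)
    {d d' : ι → ℕ} {j : ι} (hj : x ^ T < d' j) : lcmTermW w F G x d d' = 0 := by
  have hL : 0 < Real.log x := Real.log_pos hx
  have hx0 : 0 < x := by linarith
  have hlog : T < Real.log (d' j) / Real.log x := by
    rw [lt_div_iff₀ hL, ← Real.log_rpow hx0]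
    exact Real.log_lt_log (Real.rpow_pos_of_pos hx0 T) hj
  unfold lcmTermW
  refine Finset.prod_eq_zero (Finset.mem_univ j) ?_
  rw [(hG j).eq_zero _ (lt_of_le_of_lt (hT j) hlog)]
  simp

/-- The box `[1,D]^ι` grows with `D`. [folklore] -/
theorem lcmBox_mono {D D' : ℕ} (h : D ≤ D') : lcmBox ι D ⊆ lcmBox ι D' := by
  intro d hd
  simp only [lcmBox, Fintype.mem_piFinset, Finset.mem_Icc] at hd ⊢
  exact fun j => ⟨(hd j).1, (hd j).2.trans h⟩

/-- An element of a larger box outside `[1, ⌊x^T⌋]^ι` has a coordinate `> x^T`. [folklore] -/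
theorem exists_lt_of_not_mem_lcmBox {x T : ℝ} (hx : 0 ≤ x) {D : ℕ} {d : ι → ℕ}
    (hd : d ∈ lcmBox ι D) (hnot : d ∉ lcmBox ι ⌊x ^ T⌋₊) : ∃ j, x ^ T < d j := by
  simp only [lcmBox, Fintype.mem_piFinset, Finset.mem_Icc, not_forall, not_and, not_le] at hd hnot
  obtain ⟨j, hj⟩ := hnot
  exact ⟨j, (Nat.floor_lt (Real.rpow_nonneg hx T)).1 (hj (hd j).1)⟩

/-- **Beyond `D = ⌊x^T⌋` the sum (multisum) does not change** (the cutoffs vanish for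
`log_x d_j > T`). [folklore] -/
theorem lcmSumW_eq_of_le (hF : ∀ j, IsSieveCutoff (F j) (sF j))
    (hG : ∀ j, IsSieveCutoff (G j) (sG j)) (w : ℕ → ℂ) (W : ℕ) {x T : ℝ} (hx : 1 < x)
    (hTF : ∀ j, sF j ≤ T) (hTG : ∀ j, sG j ≤ T) {D : ℕ} (hD : ⌊x ^ T⌋₊ ≤ D) :
    lcmSumW w W F G x D = lcmSumW w W F G x ⌊x ^ T⌋₊ := by
  have hx0 : 0 ≤ x := by linarith
  unfold lcmSumW
  have h1 : ∀ d : ι → ℕ,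
      ∑ d' ∈ lcmBox ι D, (if LcmCoprime W d d' then lcmTermW w F G x d d' else 0) =
        ∑ d' ∈ lcmBox ι ⌊x ^ T⌋₊, (if LcmCoprime W d d' then lcmTermW w F G x d d' else 0) := by
    intro d
    symm
    refine Finset.sum_subset (lcmBox_mono (ι := ι) hD) fun d' hd' hnot => ?_
    obtain ⟨j, hj⟩ := exists_lt_of_not_mem_lcmBox (ι := ι) hx0 hd' hnot
    rw [lcmTermW_eq_zero_of_lt' hG w hx hTG hj, ite_self]
  rw [Finset.sum_congr rfl fun d _ => h1 d]
  symm
  refine Finset.sum_subset (lcmBox_mono (ι := ι) hD) fun d hd hnot => ?_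
  obtain ⟨j, hj⟩ := exists_lt_of_not_mem_lcmBox (ι := ι) hx0 hd hnot
  refine Finset.sum_eq_zero fun d' _ => ?_
  rw [lcmTermW_eq_zero_of_lt (d' := d') hF w hx hTF hj, ite_self]

end Box

/-! ### The representation `(multisum) = ∫ Φ · K` -/

section Kernel

variable {F G : ι → ℝ → ℝ} {sF sG : ι → ℝ}

/-- The kernel at the exponents `a_j = s(ξ_j)/log x`, `b_j = s(ξ'_j)/log x`:
`K_x(ξ, ξ') := K(ξ_1,…,ξ_k,ξ'_1,…,ξ'_k)` of Polymath 8b p. 12 (with the weight `w` and `W`).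
[cite: Polymath8b2014, Lemma 4.1 (proof, definition of K)] -/
def freqKernel (w : ℕ → ℂ) (W : ℕ) (x : ℝ) (p : ι → ℝ × ℝ) : ℂ :=
  eulerKernel w W (expA x p) (expB x p)

/-- `K_D(p) → K_x(p)` as `D → ∞`, for every frequency `p`. [folklore] -/
theorem tendsto_boxKernel {w : ℕ → ℂ} (hw : IsLcmWeight w) (W : ℕ) {x : ℝ} (hx : 1 < x)
    (p : ι → ℝ × ℝ) :
    Tendsto (fun D : ℕ => boxKernel w W x D p) atTop (𝓝 (freqKernel w W x p)) :=
  tendsto_sum_lcmBox_eulerTerm hw (one_div_pos.2 (Real.log_pos hx)) (expA_re_expB_re x p)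

/-- `K_x` is a.e.-strongly measurable in the frequencies (a pointwise limit of the continuous `K_D`).
[folklore] -/
theorem aestronglyMeasurable_freqKernel {w : ℕ → ℂ} (hw : IsLcmWeight w) (W : ℕ) {x : ℝ}
    (hx : 1 < x) : AEStronglyMeasurable (freqKernel (ι := ι) w W x) volume :=
  aestronglyMeasurable_of_tendsto_ae atTop
    (fun D => (continuous_boxKernel w W x D).aestronglyMeasurable)
    (ae_of_all _ fun p => tendsto_boxKernel hw W hx p)

/-- `‖K_x(p)‖ ≤ kernelBound k (1/log x)`. [folklore] -/
theorem norm_freqKernel_le {w : ℕ → ℂ} (hw : IsLcmWeight w) (W : ℕ) {x : ℝ} (hx : 1 < x)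
    (p : ι → ℝ × ℝ) : ‖freqKernel w W x p‖ ≤ kernelBound (Fintype.card ι) (1 / Real.log x) :=
  norm_eulerKernel_le hw (one_div_pos.2 (Real.log_pos hx)) (expA_re_expB_re x p)

/-- `Φ · K_x` is integrable. [folklore] -/
theorem integrable_fourierPhi_mul_freqKernel (hF : ∀ j, IsSieveCutoff (F j) (sF j))
    (hG : ∀ j, IsSieveCutoff (G j) (sG j)) {w : ℕ → ℂ} (hw : IsLcmWeight w) (W : ℕ) {x : ℝ}
    (hx : 1 < x) :
    Integrable fun p : ι → ℝ × ℝ => fourierPhi hF hG p * freqKernel w W x p := by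
  have h := (integrable_fourierPhi hF hG).bdd_mul (c := kernelBound (Fintype.card ι) (1 / Real.log x))
    (aestronglyMeasurable_freqKernel hw W hx) (ae_of_all _ fun p => norm_freqKernel_le hw W hx p)
  exact h.congr (ae_of_all _ fun p => mul_comm _ _)

/-- **(fg-int): the sum (multisum) equals `∫ Φ(ξ,ξ') K_x(ξ,ξ') dξ dξ'`** (Polymath 8b p. 12: "if we
substitute the Fourier expansions into the left-hand side of (multisum), the resulting expression
is absolutely convergent. Thus we can apply Fubini's theorem, and the left-hand side of (multisum)
can thus be rewritten as `∫…∫ K(ξ_1,…,ξ'_k) ∏_j f_j(ξ_j)g_j(ξ'_j) dξ_j dξ'_j`").  Here the sum is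
over the box `[1, ⌊x^T⌋]^{2k}` with `T` bounding the supports of the cutoffs (which is the full sum),
and the passage to the infinite kernel is by dominated convergence in `D`.
[cite: Polymath8b2014, Lemma 4.1 (proof, (fg-int))] -/
theorem lcmSumW_eq_integral_freqKernel (hF : ∀ j, IsSieveCutoff (F j) (sF j))
    (hG : ∀ j, IsSieveCutoff (G j) (sG j)) {w : ℕ → ℂ} (hw : IsLcmWeight w) (W : ℕ) {x T : ℝ}
    (hx : 1 < x) (hTF : ∀ j, sF j ≤ T) (hTG : ∀ j, sG j ≤ T) :
    lcmSumW w W F G x ⌊x ^ T⌋₊ = ∫ p : ι → ℝ × ℝ, fourierPhi hF hG p * freqKernel w W x p := by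
  -- the box sums tend to the kernel integral by dominated convergence
  have hlim : Tendsto (fun D : ℕ => ∫ p : ι → ℝ × ℝ, fourierPhi hF hG p * boxKernel w W x D p)
      atTop (𝓝 (∫ p : ι → ℝ × ℝ, fourierPhi hF hG p * freqKernel w W x p)) := by
    refine tendsto_integral_of_dominated_convergence
      (fun p => ‖fourierPhi hF hG p‖ * kernelBound (Fintype.card ι) (1 / Real.log x))
      (fun D => ((continuous_fourierPhi hF hG).mul (continuous_boxKernel w W x D)).aestronglyMeasurable)
      ((integrable_fourierPhi hF hG).norm.mul_const _)
      (fun D => ae_of_all _ fun p => ?_)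
      (ae_of_all _ fun p => (tendsto_boxKernel hw W hx p).const_mul _)
    rw [norm_mul]
    exact mul_le_mul_of_nonneg_left (norm_boxKernel_le hw W hx D p) (norm_nonneg _)
  -- while they are eventually constant
  have hconst : Tendsto (fun D : ℕ => ∫ p : ι → ℝ × ℝ, fourierPhi hF hG p * boxKernel w W x D p)
      atTop (𝓝 (lcmSumW w W F G x ⌊x ^ T⌋₊)) := by
    refine tendsto_const_nhds.congr' ?_
    filter_upwards [eventually_ge_atTop ⌊x ^ T⌋₊] with D hD
    rw [← lcmSumW_eq_integral_boxKernel hF hG w W hx D, lcmSumW_eq_of_le hF hG w W hx hTF hTG hD]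
  exact tendsto_nhds_unique hconst hlim

end Kernel

end LcmEuler

end Literature.NumberTheory.Sieve
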